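import Summits.CriticalPhenomena.Ising3DConformalLimit.Theses.PrecisionLaplacian
import Summits.CriticalPhenomena.Ising3DConformalLimit.Theses.BernsteinTemperature
import Summits.CriticalPhenomena.Ising3DConformalLimit.Theses.PrimaryAtInfinity
import Summits.CriticalPhenomena.Ising3DConformalLimit.Theses.PerfectScreening
import Summits.CriticalPhenomena.Ising3DConformalLimit.Theorems.PrecisionLaplacianMoebiusLimitOfTwoPointLawMultipoleEdge
import Summits.CriticalPhenomena.Ising3DConformalLimit.Theorems.PrecisionLaplacianMoebiusLimitOfTwoPointLawWardToMoebius
import Summits.CriticalPhenomena.Ising3DConformalLimit.Theorems.PrimaryAtInfinityMultipoleToWard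
import HarnessLib

/-!
# Crux `MoebiusLimitOfTwoPointLaw` (item stmt-CriticalPhenomena-4801) from the four OPEN items of route PrimaryAtInfinity
# (line `multipole-ward-nonsat-endpoint`, built: its two analysis items are now theorems)

With item 5357 `WardToMoebius` PROVED on this line (`wardToMoebius`, p101474) and item 5356 `MultipoleToWard` proved both on
this line (stubs `stub_farFieldCoeffContinuous` p97822 + `stub_multipoleToWardOfContinuous` p105438) and, first through the
gate, by route PrimaryAtInfinity's own prover (`Theorems.multipoleToWard_proof`, used below), the
landed dependency edge `moebiusLimitOfTwoPointLaw_of_primaryAtInfinity` (p92525) sheds its two analysis hypotheses: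
the crux follows from the four open-problem items 1342 `PerfectScreening.NonSaturation`, 5355
`PrimaryAtInfinity.ExistsRegularLimit`, 5352 `FirstMultipoleIdentity`, 5353 `FarFieldClustering`, BY NAME.
-/

noncomputable section

namespace Summit.CriticalPhenomena.Ising3DConformalLimit.PrecisionLaplacianMoebiusLimitOfTwoPointLaw

open Summit.CriticalPhenomena.Ising3DConformalLimit.Theses

/-- **The crux from the four open items of route PrimaryAtInfinity.** `NonSaturation` (1342) → `ExistsRegularLimit`
(5355) → `FirstMultipoleIdentity` (5352) → `FarFieldClustering` (5353) → `PrecisionLaplacian.MoebiusLimitOfTwoPointLaw`,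
the analysis items 5356/5357 being discharged by `Theorems.multipoleToWard_proof` / `wardToMoebius`. -/
theorem moebiusLimitOfTwoPointLaw_of_open_items :
    PerfectScreening.NonSaturation → PrimaryAtInfinity.ExistsRegularLimit →
      PrimaryAtInfinity.FirstMultipoleIdentity → PrimaryAtInfinity.FarFieldClustering →
      PrecisionLaplacian.MoebiusLimitOfTwoPointLaw :=
  fun hNS hE hM1 hFC =>
    moebiusLimitOfTwoPointLaw_of_primaryAtInfinity hNS hE hM1 hFC
      Summit.CriticalPhenomena.Ising3DConformalLimit.Theorems.multipoleToWard_proof wardToMoebius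

/-- The same under the second host route's spelling (`BernsteinTemperature.MoebiusLimitOfTwoPointLaw`). -/
theorem moebiusLimitOfTwoPointLaw_of_open_items' :
    PerfectScreening.NonSaturation → PrimaryAtInfinity.ExistsRegularLimit →
      PrimaryAtInfinity.FirstMultipoleIdentity → PrimaryAtInfinity.FarFieldClustering →
      BernsteinTemperature.MoebiusLimitOfTwoPointLaw :=
  moebiusLimitOfTwoPointLaw_of_open_items

end Summit.CriticalPhenomena.Ising3DConformalLimit.PrecisionLaplacianMoebiusLimitOfTwoPointLaw

end
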